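import Summits.NavierStokesRegularity.NavierStokesRegularity.Theorems.CoriolisHeadCounterRotatingLiouvilleHeadGrowth
import Literature.Analysis.FluidPDE.MorreySupBound

/-!
# Route CoriolisHead · crux `NoCoRotatingCore` (stmt-NavierStokesRegularity-22676) —
# pointwise polynomial bound for the velocity gradient of a bounded rotated profile

Support file (`--supports stmt-NavierStokesRegularity-22676`; theorems only, no definitions, no
named facts).  For a smooth BOUNDED solution `(U, P)` (`P ∈ C²`) of the rotated Leray profile system
`−νΔU + aU + a DU[y] + (BU − DU[By]) + DU[U] + ∇P = 0`, `div U = 0`, `ν > 0`, `a ≥ 0`, `B` skew,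
the velocity GRADIENT is polynomially bounded POINTWISE:

  `‖DU(y)‖ ≤ C (1 + |y|)^N`   (`exists_poly_bound_norm_fderiv_of_rotated`).

Every pointwise maximum-principle argument on a vorticity quantity of the crux (the spin vorticity
`ω_β = ⟪β, curl U⟫` of the registered stub `stub_posPartMaxPrinciple`, the enstrophy density
`|curl U|²`) needs this to feed Tsai's Lemma 5.1 (`isConst_of_driftOp_nonneg_skew_of_poly`), whose
growth hypothesis is pointwise.  Proof: a second Stokes–Sobolev round on top of the landed one
(`stokes_round_of_rotated`, which gives `DU ∈ L⁶_loc` with cubic growth in the centre): the body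
force `aU + a DU[y] + (BU − DU[By]) + DU[U]` is then in `L⁶(B(x₀,6))` and the pressure is
polynomially bounded (`exists_pressure_growth_of_rotated`), so the interior Stokes estimate at
`r = 6` (`stokes_interior_Lr_estimate_holds`) puts `D²U ∈ L⁶(B(x₀,3))` with polynomial growth;
Morrey's sup bound on `ℝ³` (`exists_enorm_le_eLpNorm_fderiv_add`, `p = 6 > 3`), localised with the
cutoff `suppCutoff x₀ 1` (`exists_enorm_le_eLpNorm_ball_three`), evaluates `DU(x₀)`.

HONEST FRAMING. Elliptic bookkeeping only; the crux `NoCoRotatingCore` (≡ bounded rotated-profile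
Liouville `X`, Pineau–Vicol 2026 Conj. 1.1 in bounded form) and Navier–Stokes regularity are NOT
proved here.

References: T.-P. Tsai, ARMA 143 (1998), Lemma 3.2 and (3.2) [Tsai1998]; D. Gilbarg,
N. S. Trudinger (2001), Theorem 7.10 (Morrey, case `p > n`) [GilbargTrudinger2001].
-/

noncomputable section

-- the summit and its single sub-problem share the name (CONVENTIONS §1), as in every Theorems file
set_option linter.dupNamespace false

open MeasureTheory Set Function Filter Topology InnerProductSpace Metric
open scoped RealInnerProductSpace Laplacian ContDiff BigOperators ENNReal NNReal
open Literature.Analysis.FluidPDE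

namespace Summit.NavierStokesRegularity.NavierStokesRegularity.Theorems.CoriolisHead

/-! ### Morrey's sup bound, localised to a ball -/

section LocalMorrey

variable {F : Type*} [NormedAddCommGroup F] [NormedSpace ℝ F]

/-- **Local Morrey sup bound at a point.** There is an absolute `C` with
`‖V(x₀)‖ ≤ C (‖DV‖_{L⁶(B(x₀,3))} + ‖V‖_{L⁶(B(x₀,3))})` for every `V ∈ C²(ℝ³; F)` and every `x₀`
(Morrey's whole-space bound for `p = 6 > 3` applied to `χV`, `χ = suppCutoff x₀ 1`, which is `1`
at `x₀`, supported in `B(x₀,2)`, with `|χ| ≤ 1` and `|∇χ| ≤ B` uniformly).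
[cite: GilbargTrudinger2001, Theorem 7.10 (7.26) case p > n] -/
theorem exists_enorm_le_eLpNorm_ball_three :
    ∃ C : ℝ, 0 ≤ C ∧ ∀ (V : EuclideanSpace ℝ (Fin 3) → F), ContDiff ℝ 2 V →
      ∀ x₀ : EuclideanSpace ℝ (Fin 3),
        ‖V x₀‖ₑ ≤ ENNReal.ofReal C * (eLpNorm (fun x => fderiv ℝ V x) 6 (volume.restrict (ball x₀ 3)) +
          eLpNorm V 6 (volume.restrict (ball x₀ 3))) := by
  obtain ⟨C₀, hC₀⟩ := exists_enorm_le_eLpNorm_fderiv_add (F := F) (p := 6) (by norm_num)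
    (by simp)
  obtain ⟨Bχ, hBχ0, hBχ⟩ := exists_norm_gradient_suppCutoff_le
  refine ⟨C₀ * (1 + Bχ), by positivity, fun V hV x₀ => ?_⟩
  set χ : EuclideanSpace ℝ (Fin 3) → ℝ := suppCutoff x₀ 1 with hχdef
  set g : EuclideanSpace ℝ (Fin 3) → F := fun x => χ x • V x with hgdef
  set μ : Measure (EuclideanSpace ℝ (Fin 3)) := volume.restrict (ball x₀ 3) with hμ
  have hχ2 : ContDiff ℝ 2 χ := contDiff_suppCutoff x₀ 1
  have hg2 : ContDiff ℝ 2 g := hχ2.smul hV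
  have hχd : Differentiable ℝ χ := hχ2.differentiable (by norm_num)
  have hVd : Differentiable ℝ V := hV.differentiable (by norm_num)
  have hVc : Continuous V := hV.continuous
  have hDVc : Continuous fun x => fderiv ℝ V x := hV.continuous_fderiv (by norm_num)
  -- `g(x₀) = V(x₀)`
  have hgx₀ : g x₀ = V x₀ := by
    have h1 : χ x₀ = 1 := suppCutoff_eq_one one_pos (by simp)
    simp [hgdef, h1]
  -- supports inside `B(x₀, 3)`
  have hsupp : support g ⊆ ball x₀ 2 := by
    intro x hx
    rw [mem_ball, dist_eq_norm]
    by_contra h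
    push Not at h
    have h0 : χ x = 0 := suppCutoff_eq_zero one_pos (by linarith)
    exact hx (by simp [hgdef, h0])
  have hsupp3 : support g ⊆ ball x₀ 3 := hsupp.trans (ball_subset_ball (by norm_num))
  have htsupp : tsupport g ⊆ ball x₀ 3 :=
    (closure_mono hsupp).trans (closure_ball_subset_closedBall.trans
      (closedBall_subset_ball (by norm_num)))
  have hsuppD : support (fderiv ℝ g) ⊆ ball x₀ 3 := (support_fderiv_subset ℝ).trans htsupp
  -- `‖g‖₆ ≤ ‖V‖_{L⁶(B₃)}`
  have hg6 : eLpNorm g 6 volume ≤ eLpNorm V 6 μ := by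
    have hr : eLpNorm g 6 volume = eLpNorm g 6 μ := by
      rw [hμ, eLpNorm_restrict_eq_of_support_subset hsupp3]
    rw [hr]
    refine eLpNorm_mono fun x => ?_
    rw [hgdef]
    dsimp only
    rw [norm_smul, Real.norm_eq_abs]
    exact mul_le_of_le_one_left (norm_nonneg _) (abs_suppCutoff_le_one x₀ 1 x)
  -- `‖Dg‖₆ ≤ ‖DV‖_{L⁶(B₃)} + Bχ ‖V‖_{L⁶(B₃)}`
  have hDg_pt : ∀ x, ‖fderiv ℝ g x‖ ≤ ‖fderiv ℝ V x‖ + Bχ * ‖V x‖ := by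
    intro x
    have hd : fderiv ℝ g x = χ x • fderiv ℝ V x + (fderiv ℝ χ x).smulRight (V x) := by
      rw [hgdef]; exact fderiv_fun_smul (hχd x) (hVd x)
    rw [hd]
    refine (norm_add_le _ _).trans (add_le_add ?_ ?_)
    · rw [norm_smul, Real.norm_eq_abs]
      exact mul_le_of_le_one_left (norm_nonneg _) (abs_suppCutoff_le_one x₀ 1 x)
    · rw [ContinuousLinearMap.norm_smulRight_apply]
      gcongr
      have : ‖gradient χ x‖ = ‖fderiv ℝ χ x‖ := by rw [gradient, LinearIsometryEquiv.norm_map]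
      rw [← this]
      exact hBχ x₀ x
  have hmeas1 : AEStronglyMeasurable (fun x => ‖fderiv ℝ V x‖) μ := hDVc.norm.aestronglyMeasurable
  have hmeas2 : AEStronglyMeasurable (fun x => Bχ * ‖V x‖) μ :=
    (continuous_const.mul hVc.norm).aestronglyMeasurable
  have hDg6 : eLpNorm (fderiv ℝ g) 6 volume ≤
      eLpNorm (fun x => fderiv ℝ V x) 6 μ + ENNReal.ofReal Bχ * eLpNorm V 6 μ := by
    have hr : eLpNorm (fderiv ℝ g) 6 volume = eLpNorm (fderiv ℝ g) 6 μ := by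
      rw [hμ]
      exact (eLpNorm_restrict_eq_of_support_subset (f := fderiv ℝ g) (s := ball x₀ 3)
        (μ := volume) (p := 6) fun x hx => hsuppD hx).symm
    rw [hr]
    calc eLpNorm (fderiv ℝ g) 6 μ
        ≤ eLpNorm (fun x => ‖fderiv ℝ V x‖ + Bχ * ‖V x‖) 6 μ := eLpNorm_mono_real hDg_pt
      _ = eLpNorm ((fun x => ‖fderiv ℝ V x‖) + fun x => Bχ * ‖V x‖) 6 μ := rfl
      _ ≤ eLpNorm (fun x => ‖fderiv ℝ V x‖) 6 μ + eLpNorm (fun x => Bχ * ‖V x‖) 6 μ :=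
          eLpNorm_add_le hmeas1 hmeas2 (by norm_num)
      _ = eLpNorm (fun x => fderiv ℝ V x) 6 μ + ENNReal.ofReal Bχ * eLpNorm V 6 μ := by
          rw [eLpNorm_norm]
          have : (fun x => Bχ * ‖V x‖) = Bχ • fun x => ‖V x‖ := by
            funext x; simp [smul_eq_mul]
          rw [this, eLpNorm_const_smul, eLpNorm_norm, Real.enorm_eq_ofReal_abs, abs_of_nonneg hBχ0]
  -- assemble
  calc ‖V x₀‖ₑ = ‖g x₀‖ₑ := by rw [hgx₀]
    _ ≤ C₀ * (eLpNorm (fderiv ℝ g) 6 volume + eLpNorm g 6 volume) := hC₀ g hg2 x₀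
    _ ≤ C₀ * ((eLpNorm (fun x => fderiv ℝ V x) 6 μ + ENNReal.ofReal Bχ * eLpNorm V 6 μ) +
          eLpNorm V 6 μ) := by gcongr
    _ ≤ ENNReal.ofReal (C₀ * (1 + Bχ)) * (eLpNorm (fun x => fderiv ℝ V x) 6 μ + eLpNorm V 6 μ) := by
        rw [ENNReal.ofReal_mul (by positivity), ENNReal.ofReal_coe_nnreal,
          ENNReal.ofReal_add zero_le_one hBχ0, ENNReal.ofReal_one]
        set D := eLpNorm (fun x => fderiv ℝ V x) 6 μ
        set W := eLpNorm V 6 μ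
        set b := ENNReal.ofReal Bχ
        have hin : (D + b * W) + W ≤ (1 + b) * (D + W) :=
          calc (D + b * W) + W ≤ (D + b * W) + W + b * D := le_self_add
            _ = (1 + b) * (D + W) := by ring
        calc (C₀ : ℝ≥0∞) * ((D + b * W) + W) ≤ (C₀ : ℝ≥0∞) * ((1 + b) * (D + W)) := by gcongr
          _ = (C₀ : ℝ≥0∞) * (1 + b) * (D + W) := by ring

end LocalMorrey

/-! ### The second Stokes round and the pointwise gradient bound -/

section GradientBound

-- nested operator types `ℝ³ →L[ℝ] ℝ³ →L[ℝ] ℝ³`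
set_option maxSynthPendingDepth 3

variable {ν a : ℝ} {B : EuclideanSpace ℝ (Fin 3) →L[ℝ] EuclideanSpace ℝ (Fin 3)}
  {U : EuclideanSpace ℝ (Fin 3) → EuclideanSpace ℝ (Fin 3)} {P : EuclideanSpace ℝ (Fin 3) → ℝ}

/-- A pointwise polynomial bound `|f(x)| ≤ C (1 + |x|)^N` gives `‖f‖_{L⁶(B(x₀,6))} ≤ K (1 + |x₀|)^N`
uniformly in the centre (`1 + |x| ≤ 7 (1 + |x₀|)` on the ball; the volume of the ball is a
constant). -/
theorem exists_eLpNorm_six_ball_le_of_pointwise {f : EuclideanSpace ℝ (Fin 3) → ℝ}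
    {C : ℝ} (hC : 0 ≤ C) {N : ℕ} (hb : ∀ x, |f x| ≤ C * (1 + ‖x‖) ^ N) :
    ∃ K : ℝ, 0 ≤ K ∧ ∀ x₀ : EuclideanSpace ℝ (Fin 3),
      eLpNorm (fun x => f x - 0) 6 (volume.restrict (ball x₀ 6)) ≤ ENNReal.ofReal (K * (1 + ‖x₀‖) ^ N) := by
  set V : ℝ≥0∞ := volume (ball (0 : EuclideanSpace ℝ (Fin 3)) 6) ^ (6 : ℝ≥0∞).toReal⁻¹ with hV
  have hVlt : V < ⊤ := ENNReal.rpow_lt_top_of_nonneg (by positivity) measure_ball_lt_top.ne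
  refine ⟨V.toReal * (C * 7 ^ N), by positivity, fun x₀ => ?_⟩
  have hbound : ∀ᵐ x ∂(volume.restrict (ball x₀ 6)), ‖(fun x => f x - 0) x‖ ≤ C * 7 ^ N * (1 + ‖x₀‖) ^ N := by
    filter_upwards [ae_restrict_mem measurableSet_ball] with x hx
    rw [mem_ball, dist_eq_norm] at hx
    have hx' : ‖x‖ ≤ ‖x₀‖ + 6 := by
      have := norm_le_norm_add_norm_sub' x x₀
      have h2 : ‖x - x₀‖ ≤ 6 := hx.le
      linarith [norm_sub_rev x x₀]
    have h7 : 1 + ‖x‖ ≤ 7 * (1 + ‖x₀‖) := by nlinarith [norm_nonneg x₀]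
    rw [sub_zero, Real.norm_eq_abs]
    calc |f x| ≤ C * (1 + ‖x‖) ^ N := hb x
      _ ≤ C * (7 * (1 + ‖x₀‖)) ^ N := by gcongr
      _ = C * 7 ^ N * (1 + ‖x₀‖) ^ N := by rw [mul_pow]; ring
  refine (eLpNorm_le_of_ae_bound hbound).trans ?_
  rw [Measure.restrict_apply_univ, Measure.addHaar_ball_center, ← hV]
  have hVeq : V = ENNReal.ofReal V.toReal := (ENNReal.ofReal_toReal hVlt.ne).symm
  rw [hVeq, ← ENNReal.ofReal_mul ENNReal.toReal_nonneg]
  exact ENNReal.ofReal_le_ofReal (by rw [ENNReal.toReal_ofReal ENNReal.toReal_nonneg]; ring_nf; rfl)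

/-- **Second Stokes–Sobolev round for a bounded rotated profile.** For `U ∈ C^∞` bounded,
`P ∈ C²`, `B` skew, `ν > 0`, `a ≥ 0`: `‖D²U‖_{L⁶(B(x₀,3))}` and `‖DU‖_{L⁶(B(x₀,3))}` are bounded
by `K (1 + |x₀|)^m` uniformly in the centre.  (The landed first round `stokes_round_of_rotated`
at `R = 2` gives `DU ∈ L⁶(B(x₀,6))` with cubic growth; then the body force is in `L⁶(B(x₀,6))`
(`exists_poly_bound_bodyForce_of_rotated`), the pressure is polynomially bounded
(`exists_pressure_growth_of_rotated`), and the interior Stokes estimate at `r = 6`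
(`exists_poly_bound_stokes_of_rotated`, `stokes_interior_Lr_estimate_holds`) bounds `D²U`.)
[cite: Tsai1998, (3.2) and Lemma 3.2 (p. 37–38)] -/
theorem exists_poly_bound_hessian_six_of_rotated (hU : ContDiff ℝ ∞ U) (hP2 : ContDiff ℝ 2 P)
    (hB : ∀ x, ⟪B x, x⟫ = 0) (hdiv : VectorCalculus.IsDivFree U)
    (heq : ∀ y, -(ν • (Δ U) y) + a • U y + a • fderiv ℝ U y y + (B (U y) - fderiv ℝ U y (B y)) +
      convect U U y + gradient P y = 0)
    (hν : 0 < ν) (ha : 0 ≤ a) {M : ℝ} (hM : ∀ y, ‖U y‖ ≤ M) :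
    ∃ (K : ℝ) (m : ℕ), 0 ≤ K ∧ ∀ x₀ : EuclideanSpace ℝ (Fin 3),
      eLpNorm (fun x => iteratedFDeriv ℝ 2 U x) 6 (volume.restrict (ball x₀ 3)) ≤
          ENNReal.ofReal (K * (1 + ‖x₀‖) ^ m) ∧
      eLpNorm (fun x => fderiv ℝ U x) 6 (volume.restrict (ball x₀ 3)) ≤
          ENNReal.ofReal (K * (1 + ‖x₀‖) ^ m) := by
  have hUc : Continuous U := hU.continuous
  have hU1 : ContDiff ℝ 1 U := hU.of_le (by norm_cast)
  have hUq : MemLp U ∞ volume :=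
    memLp_top_of_bound hUc.aestronglyMeasurable M (Eventually.of_forall hM)
  have ht0 : ∀ x₀ : EuclideanSpace ℝ (Fin 3), 0 ≤ ‖x₀‖ := fun _ => norm_nonneg _
  -- local pressure control at radius `2000` and the first round with `R = 2`
  obtain ⟨KP, hKP, hPl⟩ := exists_local_pressure_bound_of_four_le_of_rotated hU hP2 hB hdiv heq
    hν.le ha (by norm_num : (0 : ℝ) < 2000) (q := ∞) le_top hUq
  set c : EuclideanSpace ℝ (Fin 3) → ℝ := fun x₀ => P x₀ - normalisedPressure
    (fun w : EuclideanSpace ℝ (Fin 3) => cutoff (4 * 2000) (w - x₀) • U w) x₀ with hc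
  have hPc : ∀ x₀ : EuclideanSpace ℝ (Fin 3), eLpNorm (fun x => P x - c x₀) 2
      (volume.restrict (ball x₀ (1000 * 2))) ≤ ENNReal.ofReal (KP * (1 + ‖x₀‖)) := fun x₀ => by
    rw [show (1000 : ℝ) * 2 = 2000 by norm_num]; exact (hPl x₀).2
  obtain ⟨KB, hKB, hBs⟩ := stokes_round_of_rotated stokes_interior_Lr_estimate_holds hU hP2 hB
    hdiv heq hν ha hM (by norm_num : (0 : ℝ) < 2) hKP hPc
  -- `DU ∈ L⁶(B(x₀,6))`, degree 3
  have hDU6 : ∀ x₀ : EuclideanSpace ℝ (Fin 3), eLpNorm (fun x => fderiv ℝ U x) 6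
      (volume.restrict (ball x₀ 6)) ≤ ENNReal.ofReal (KB * (1 + ‖x₀‖) ^ 3) := fun x₀ => by
    rw [show (6 : ℝ) = 3 * 2 by norm_num]; exact (hBs x₀).2.2.2.1
  -- `U ∈ L⁶(B(x₀,6))` uniformly
  obtain ⟨CU6, hCU60, hCU6⟩ := exists_eLpNorm_restrict_ball_le_of_memLp hUc hUq (s := 6)
    (by norm_num) le_top (6 : ℝ)
  -- body force in `L⁶(B(x₀,6))`, degree `4`
  obtain ⟨KF, hKF, hF⟩ := exists_poly_bound_bodyForce_of_rotated hU1 a B hM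
    (by norm_num : (0 : ℝ) < 6) (p := 6) (by norm_num) hCU60 hKB (m₁ := 0) (m₂ := 3)
    (poly_zero_of_uniform hCU6 0 hCU60) hDU6
  have hdeg : max 0 (3 + 1) = 4 := by norm_num
  rw [hdeg] at hF
  -- the pressure is polynomially bounded, hence in `L⁶(B(x₀,6))` with polynomial growth
  obtain ⟨N₁, C₁, R₁, hPR⟩ := exists_pressure_growth_of_rotated hU hP2 hB hdiv heq hν ha hM
  obtain ⟨C', hC'0, hC'⟩ := exists_poly_bound_of_eventually_le hP2.continuous hPR
  obtain ⟨KP6, hKP6, hP6⟩ := exists_eLpNorm_six_ball_le_of_pointwise hC'0 hC'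
  -- common degree
  set m : ℕ := N₁ + 4 with hm
  have h6 : (6 : ℝ) = 2 * 3 := by norm_num
  have hF' : ∀ x₀ : EuclideanSpace ℝ (Fin 3), eLpNorm (fun x => a • U x + a • fderiv ℝ U x x +
      (B (U x) - fderiv ℝ U x (B x)) + convect U U x) 6 (volume.restrict (ball x₀ (2 * 3))) ≤
      ENNReal.ofReal (KF * (1 + ‖x₀‖) ^ m) := fun x₀ => by
    rw [← h6]; exact (hF x₀).trans (ofReal_poly_le_of_le hKF (ht0 x₀) (by omega))
  have hU' : ∀ x₀ : EuclideanSpace ℝ (Fin 3), eLpNorm U 6 (volume.restrict (ball x₀ (2 * 3))) ≤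
      ENNReal.ofReal (CU6 * (1 + ‖x₀‖) ^ m) := fun x₀ => by
    rw [← h6]; exact poly_zero_of_uniform hCU6 m hCU60 x₀
  have hDU' : ∀ x₀ : EuclideanSpace ℝ (Fin 3), eLpNorm (fun x => fderiv ℝ U x) 6
      (volume.restrict (ball x₀ (2 * 3))) ≤ ENNReal.ofReal (KB * (1 + ‖x₀‖) ^ m) := fun x₀ => by
    rw [← h6]; exact (hDU6 x₀).trans (ofReal_poly_le_of_le hKB (ht0 x₀) (by omega))
  have hP' : ∀ x₀ : EuclideanSpace ℝ (Fin 3), eLpNorm (fun x => P x - (fun _ : EuclideanSpace ℝ (Fin 3) => (0 : ℝ)) x₀) 6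
      (volume.restrict (ball x₀ (2 * 3))) ≤ ENNReal.ofReal (KP6 * (1 + ‖x₀‖) ^ m) := fun x₀ => by
    rw [← h6]; exact (hP6 x₀).trans (ofReal_poly_le_of_le hKP6 (ht0 x₀) (by omega))
  -- the Stokes estimate at `r = 6`, `S = 3`
  obtain ⟨K₂, hK₂, hS⟩ := exists_poly_bound_stokes_of_rotated stokes_interior_Lr_estimate_holds hU
    hP2 hdiv heq hν (r := 6) (by norm_num) (by simp) (by norm_num : (0 : ℝ) < 3)
    (c := fun _ => (0 : ℝ)) hKF hCU60 hKB hKP6 hF' hU' hDU' hP'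
  refine ⟨max K₂ KB, m, le_max_of_le_left hK₂, fun x₀ => ⟨?_, ?_⟩⟩
  · exact (hS x₀).1.trans (ENNReal.ofReal_le_ofReal (by gcongr; exact le_max_left _ _))
  · calc eLpNorm (fun x => fderiv ℝ U x) 6 (volume.restrict (ball x₀ 3))
        ≤ eLpNorm (fun x => fderiv ℝ U x) 6 (volume.restrict (ball x₀ 6)) :=
          eLpNorm_restrict_ball_mono _ _ x₀ (by norm_num)
      _ ≤ ENNReal.ofReal (KB * (1 + ‖x₀‖) ^ m) :=
          (hDU6 x₀).trans (ofReal_poly_le_of_le hKB (ht0 x₀) (by omega))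
      _ ≤ ENNReal.ofReal (max K₂ KB * (1 + ‖x₀‖) ^ m) :=
          ENNReal.ofReal_le_ofReal (by gcongr; exact le_max_right _ _)

/-- **Pointwise polynomial bound for the velocity gradient of a bounded rotated profile.**  For
`U ∈ C^∞(ℝ³; ℝ³)` bounded, `P ∈ C²`, `B` skew, `ν > 0`, `a ≥ 0` solving
`−νΔU + aU + a DU[y] + (BU − DU[By]) + DU[U] + ∇P = 0`, `div U = 0`, there are `C ≥ 0` and `N`
with `‖DU(y)‖ ≤ C (1 + |y|)^N` for all `y` (second Stokes round + local Morrey bound applied to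
`V = DU`, whose derivative has the norm of `D²U`). [cite: Tsai1998, Lemma 3.2 (p. 37–38); GilbargTrudinger2001, Theorem 7.10 case p > n] -/
theorem exists_poly_bound_norm_fderiv_of_rotated (hU : ContDiff ℝ ∞ U) (hP2 : ContDiff ℝ 2 P)
    (hB : ∀ x, ⟪B x, x⟫ = 0) (hdiv : VectorCalculus.IsDivFree U)
    (heq : ∀ y, -(ν • (Δ U) y) + a • U y + a • fderiv ℝ U y y + (B (U y) - fderiv ℝ U y (B y)) +
      convect U U y + gradient P y = 0)
    (hν : 0 < ν) (ha : 0 ≤ a) {M : ℝ} (hM : ∀ y, ‖U y‖ ≤ M) :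
    ∃ (C : ℝ) (N : ℕ), 0 ≤ C ∧ ∀ y : EuclideanSpace ℝ (Fin 3), ‖fderiv ℝ U y‖ ≤ C * (1 + ‖y‖) ^ N := by
  obtain ⟨K, m, hK, hKb⟩ := exists_poly_bound_hessian_six_of_rotated hU hP2 hB hdiv heq hν ha hM
  obtain ⟨C, hC0, hC⟩ := exists_enorm_le_eLpNorm_ball_three
    (F := EuclideanSpace ℝ (Fin 3) →L[ℝ] EuclideanSpace ℝ (Fin 3))
  have hV2 : ContDiff ℝ 2 (fun x => fderiv ℝ U x) := hU.fderiv_right (m := 2) (by norm_cast)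
  refine ⟨C * (2 * K), m, by positivity, fun y => ?_⟩
  have ht : 0 ≤ ‖y‖ := norm_nonneg _
  have h := hC (fun x => fderiv ℝ U x) hV2 y
  -- the derivative of `DU` has the norm of `D²U`
  have hnorm : ∀ x, ‖fderiv ℝ (fun z => fderiv ℝ U z) x‖ = ‖iteratedFDeriv ℝ 2 U x‖ := fun x => by
    rw [← norm_iteratedFDeriv_zero (𝕜 := ℝ) (f := fderiv ℝ (fun z => fderiv ℝ U z)),
      norm_iteratedFDeriv_fderiv, show (fun z => fderiv ℝ U z) = fderiv ℝ U from rfl,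
      norm_iteratedFDeriv_fderiv]
  have hcongr : eLpNorm (fun x => fderiv ℝ (fun z => fderiv ℝ U z) x) 6 (volume.restrict (ball y 3)) =
      eLpNorm (fun x => iteratedFDeriv ℝ 2 U x) 6 (volume.restrict (ball y 3)) :=
    eLpNorm_congr_norm_ae (Eventually.of_forall hnorm)
  rw [hcongr] at h
  have h2 : ‖fderiv ℝ U y‖ₑ ≤ ENNReal.ofReal (C * (2 * K) * (1 + ‖y‖) ^ m) := by
    refine h.trans ?_
    calc ENNReal.ofReal C * (eLpNorm (fun x => iteratedFDeriv ℝ 2 U x) 6 (volume.restrict (ball y 3)) +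
          eLpNorm (fun x => fderiv ℝ U x) 6 (volume.restrict (ball y 3)))
        ≤ ENNReal.ofReal C * (ENNReal.ofReal (K * (1 + ‖y‖) ^ m) + ENNReal.ofReal (K * (1 + ‖y‖) ^ m)) := by
          gcongr
          · exact (hKb y).1
          · exact (hKb y).2
      _ = ENNReal.ofReal (C * (2 * K) * (1 + ‖y‖) ^ m) := by
          rw [← ENNReal.ofReal_add (by positivity) (by positivity), ← ENNReal.ofReal_mul hC0]
          ring_nf
  rw [← ofReal_norm] at h2
  exact (ENNReal.ofReal_le_ofReal_iff (by positivity)).1 h2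

end GradientBound

/-- **Pointwise polynomial gradient bound, route format.**  For a smooth bounded rotated Leray
profile in the hypotheses of route CoriolisHead (`ν, a > 0`, skew `B`, `U ∈ C^∞` bounded,
`P ∈ C²`, `div U = 0`, the profile system pointwise), `‖DU(y)‖ ≤ C (1 + |y|)^N`.
[cite: Tsai1998, Lemma 3.2 (p. 37–38)] -/
theorem rotatedProfile_poly_bound_fderiv (ν a : ℝ) (hν : 0 < ν) (ha : 0 < a)
    (B : EuclideanSpace ℝ (Fin 3) →L[ℝ] EuclideanSpace ℝ (Fin 3))
    (U : EuclideanSpace ℝ (Fin 3) → EuclideanSpace ℝ (Fin 3)) (P : EuclideanSpace ℝ (Fin 3) → ℝ)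
    (hU : ContDiff ℝ (⊤ : ℕ∞) U) (hP : ContDiff ℝ 2 P) (hB : ∀ x, inner ℝ (B x) x = 0)
    (hdiv : VectorCalculus.IsDivFree U)
    (heq : ∀ y, -(ν • Laplacian.laplacian U y) + a • U y + a • fderiv ℝ U y y
      + (B (U y) - fderiv ℝ U y (B y)) + convect U U y + gradient P y = 0)
    (hbdd : ∃ M : ℝ, ∀ y, ‖U y‖ ≤ M) :
    ∃ (C : ℝ) (N : ℕ), 0 ≤ C ∧ ∀ y, ‖fderiv ℝ U y‖ ≤ C * (1 + ‖y‖) ^ N := by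
  obtain ⟨M, hM⟩ := hbdd
  exact exists_poly_bound_norm_fderiv_of_rotated hU hP hB hdiv heq hν ha.le hM



end Summit.NavierStokesRegularity.NavierStokesRegularity.Theorems.CoriolisHead

end
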